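import Summits.HodgeConjecture.HodgeConjecture.Theorems.Ring2AbelianAllEllipticTensorWeilCarriersDefs
import HarnessLib

/-!
# Ring 2 / AbelianAll (André column) — the node «ONE CARRIED `E`-WEIL CLASS PER TENSOR STRUCTURE OVER ONE ELLIPTIC CURVE» (definitions only)

research route, not a corollary; conditional on HC_CM plus one named minimal statement.

DEFINITIONS ONLY (nothing asserted, nothing proved; `HC_CM` absent). PART AC-f's node `EllipticTensorWeilCarriers 𝒪 E₀` asks, on every polarised abelian
variety `X ≅ A₀` isogenous to a power of `E₀` and for every CM-field structure `ψ₀` on `A₀`, an `𝒪`-carrier for EVERY rational class of the `E`-Weil space of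
`(A₀, ψ₀)` — per structure a `ℚ`-space of dimension `[E:ℚ]`. André's proof of Lemme 6.3.3 (p. 33 with a), p. 32: `G = Res SU(V, φ)` fixes the `E`-line
`⋀^{2p}_E V` POINTWISE) extends EVERY `E`-Weil class of the tensor fibre to a global section landing in the `E`-Weil line of the anchored variety
(Literature `Andre1996.IsWeilLineAnchoredPencilFor`, statement only, this generation), and the `E`-Weil line of a Weil-type datum is algebraic as soon as ONE
non-zero rational class in it is (the one-class lemma `weilClassesField_le_algebraicClasses_of_isRationalClass_of_ne_zero`: `E` acts by algebraic
correspondences, `dim_E W_E = 1`). So ONE carried class per tensor structure suffices. This file names that node in the road's vocabulary: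

* `carriedClasses 𝒪 n p` (served-class map, reducible): the classes `w` on `(X, θ)` that HAVE an `𝒪`-datum `(I ∋ p, κ)` with `κ_p = a·w + c_p·θᵖ`, `a ≠ 0`,
  `κ_q = c_q·θ^q` (`q ∈ I`, `q ≠ p`) — so that `AnchoredCarrierAt 𝒪 n p 𝔄 (carriedClasses 𝒪 n p)` is a tautology for every anchor predicate `𝔄` (companion file)
  and the road's served-fibre engine applies to any class with a datum.
* `OneTensorWeilClassCarriers 𝒪 E₀` (`@[conjecture]`, door-generic): for all `n`, `p` with `2 ≤ p ≤ n − 2`, every `X` with a polarisation class `θ`, every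
  `A₀ ≅ X` of dimension `n` isogenous to a power of `E₀` and every endomorphism `ψ₀` of `A₀`: IF `ψ₀` is an imaginary-quadratic structure (`ψ₀² = -δ`, `n = 2p`)
  THEN some NON-ZERO rational class `w` on `X` with `e^*w ∈ weilClassesOf A₀ ψ₀ p δ` is carried, AND IF `(ψ₀, P)` is a CM-field presentation of degree `e' > 2`
  (`n = p·e'`; binders verbatim those of `weilStructureServedClasses`) THEN some non-zero rational `w` with `e^*w ∈ weilClassesField A₀ ψ₀ P (2p)` is carried.
  ONE class per structure and polarisation, of our choice.
* `OneTensorWeilClassTwistedCarriers E₀` (`@[conjecture]`): the same for the road's twisted door `twistedReflexiveClass C AdmTw`, every `C`.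

Both nodes are OPEN, not in print, NOT implied by the Hodge conjecture (they ask for sheaves, not cycles); HYPOTHESES wherever used; implied by
`EllipticTensorWeilCarriers 𝒪 E₀` (companion file: any non-zero rational Weil class will do). With the line facts and the door: `HC_CM` and `AndreSplitWeilClasses`
(companion files). References: [cite: Andre1996Motifs, §6.3 a) (p. 32), Lemme 6.3.3 and proof (p. 33)] [cite: MoonenZarhin1998WeilClasses, §1 (dim_F W_F = 1)]
[cite: Markman2025SurveySecant, §4 (one class suffices)] [cite: Bloch1972Semiregularity, Remark (7.5)] [cite: BuchweitzFlenner2003, §5 Thm. 5.1]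
[cite: Markman2025SecantWeil, §7.3].
-/

noncomputable section

open CategoryTheory CategoryTheory.Limits AlgebraicGeometry Topology

namespace Summit.HodgeConjecture.HodgeConjecture.Ring2.AbelianAll

-- the cell's namespace repeats the summit name (`Summit.HodgeConjecture.HodgeConjecture…`), as in every `Ring2*` file
set_option linter.dupNamespace false

open Literature.AlgebraicGeometry Literature.AlgebraicGeometry.Motives
open Literature.AlgebraicGeometry.HodgeTheory
open Literature.AlgebraicTopology.SingularHomology
open Summit.Ventures.HSemireg (ObjClass)
open Summit.HodgeConjecture.HodgeConjecture.Ring2.SemiregularRepresentatives (AnchoredCarrierAt)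

/-- **The classes on `(X, θ)` that HAVE an `𝒪`-datum** (served-class map, reducible): `w ∈ H^{2p}(X(ℂ); ℂ)` with degrees `I ∋ p`, classes `κ` admissible for `𝒪`
ON `X`, `a ≠ 0` and scalars `c_q` such that `κ_p = a·w + c_p·θᵖ` and `κ_q = c_q·θ^q` (`q ∈ I`, `q ≠ p`) — the conclusion of `AnchoredCarrierAt` as a set, so
that `AnchoredCarrierAt 𝒪 n p 𝔄 (carriedClasses 𝒪 n p)` holds tautologically. [cite: Bloch1972Semiregularity, Remark (7.5)] [cite: BuchweitzFlenner2003, §5 Thm. 5.1] -/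
abbrev carriedClasses (𝒪 : ObjClass) (n p : ℕ) : ∀ X : SchemeOver ℂ, complexBetti X 2 → Set (complexBetti X (2 * p)) :=
  fun X θ ↦ {w | ∃ (I : Finset ℕ) (κ : (q : ℕ) → complexBetti X (2 * q)) (a : ℂ) (c : ℕ → ℂ),
    p ∈ I ∧ 𝒪 n X I κ ∧ a ≠ 0 ∧ κ p = a • w + c p • cupPowTwo θ p ∧ ∀ q ∈ I, q ≠ p → κ q = c q • cupPowTwo θ q}

/-- **ONE CARRIED `E`-WEIL CLASS PER TENSOR STRUCTURE OVER THE ELLIPTIC CURVE `E₀`, for the door `𝒪` (`OneTensorWeilClassCarriers 𝒪 E₀`)**: for all `n`, `p` with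
`2 ≤ p ≤ n − 2`, every complex scheme `X` with a polarisation class `θ`, every abelian `n`-fold `A₀ ≅ X` (chart `e`) isogenous to a power of `E₀`, and every
endomorphism `ψ₀` of `A₀`: if `ψ₀ ≫ ψ₀ = -δ` (`δ ≥ 1`, `n = 2p`; imaginary quadratic structure) then SOME non-zero RATIONAL class `w` on `X` with
`e^*w ∈ weilClassesOf A₀ ψ₀ p δ` has an `𝒪`-datum modulo the `θ`-ray (`w ∈ carriedClasses 𝒪 n p X θ`); and if `(ψ₀, P)` is a CM-field presentation of degree
`e' > 2` (`P` monic irreducible, `P(ψ₀) = 0`, no real root, complex conjugation induced by some `Q ∈ ℚ[T]`, `n = p·e'`) then SOME non-zero rational `w` with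
`e^*w ∈ weilClassesField A₀ ψ₀ P (2p)` has one. ONE class per structure and polarisation — versus ALL of them in `EllipticTensorWeilCarriers 𝒪 E₀`, which implies
it. With the line facts `andre1996_splitWeilClasses_weilLinePencil` / `andre1996_cmHodgeClasses_weilLinePencils` and the door: `AndreSplitWeilClasses` and `HC_CM`
(companion files). OPEN; not in print; a HYPOTHESIS wherever used. [cite: Andre1996Motifs, §6.3 a) (p. 32), Lemme 6.3.3 and proof (p. 33)]
[cite: MoonenZarhin1998WeilClasses, §1] [cite: Markman2025SurveySecant, §4] [cite: Bloch1972Semiregularity, Remark (7.5)] -/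
@[conjecture] def OneTensorWeilClassCarriers (𝒪 : ObjClass) (E₀ : AbelianVariety ℂ) : Prop :=
  ∀ n p : ℕ, 2 ≤ p → p + 2 ≤ n →
    ∀ (X : SchemeOver ℂ) (θ : complexBetti X 2), IsPolarizationClass n X θ →
      ∀ (A₀ : AbelianVariety ℂ) (e : A₀.X ≅ X) (N : ℕ) (ψ₀ : A₀ ⟶ A₀), A₀.dim = n → A₀.IsIsogenous (E₀.powSucc N) →
        (∀ δ : ℕ, 0 < δ → ψ₀ ≫ ψ₀ = -(δ • 𝟙 A₀) → n = 2 * p →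
            ∃ w : complexBetti X (2 * p), IsRationalClass w ∧ w ≠ 0 ∧
              complexBetti.map e.hom (2 * p) w ∈ weilClassesOf A₀ ψ₀ p δ ∧ w ∈ carriedClasses 𝒪 n p X θ) ∧
        (∀ (P : Polynomial ℤ) (e' : ℕ),
            P.Monic → P.natDegree = e' → 2 < e' → Irreducible (P.map (Int.castRingHom ℚ)) →
            Polynomial.eval₂ (Int.castRingHom (CategoryTheory.End A₀)) (ψ₀ : CategoryTheory.End A₀) P = 0 →
            n = p * e' →
            (∀ ρ : ℂ, Polynomial.eval₂ (Int.castRingHom ℂ) ρ P = 0 → starRingEnd ℂ ρ ≠ ρ) →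
            (∃ Q : Polynomial ℚ, ∀ ρ : ℂ, Polynomial.eval₂ (Int.castRingHom ℂ) ρ P = 0 →
                Polynomial.eval₂ (algebraMap ℚ ℂ) ρ Q = starRingEnd ℂ ρ) →
              ∃ w : complexBetti X (2 * p), IsRationalClass w ∧ w ≠ 0 ∧
                complexBetti.map e.hom (2 * p) w ∈ weilClassesField A₀ ψ₀ P (2 * p) ∧ w ∈ carriedClasses 𝒪 n p X θ)

/-- **ONE TWISTED CARRIER PER TENSOR STRUCTURE OVER `E₀` (`OneTensorWeilClassTwistedCarriers E₀`)**: `OneTensorWeilClassCarriers` for the road's twisted door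
`twistedReflexiveClass C AdmTw` (`AdmTw := gluableSigmaAdmissible ∨ bfSingleAdmissible`), every Chern character theory `C`. OPEN; not in print; a HYPOTHESIS
wherever used. [cite: Bloch1972Semiregularity, Remark (7.5)] [cite: Markman2025SecantWeil, §7.3] [cite: BuchweitzFlenner2003, §5 Thm. 5.1] -/
@[conjecture] def OneTensorWeilClassTwistedCarriers (E₀ : AbelianVariety ℂ) : Prop :=
  ∀ C : ChernCharacterBetti, OneTensorWeilClassCarriers (twistedReflexiveClass C
    (fun n X₀ I E => Summit.Ventures.HSemireg.gluableSigmaAdmissible n X₀ I E ∨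
      Literature.AlgebraicGeometry.HodgeTheory.bfSingleAdmissible n X₀ I E)) E₀

/-! ## §2 (appended) The GUARDED node: one carried class per tensor structure THAT HAS A NON-ZERO RATIONAL HODGE WEIL CLASS

ERRATUM-BY-REFINEMENT (append-only; §1 unchanged). `OneTensorWeilClassCarriers 𝒪 E₀` quantifies over ALL endomorphisms `ψ₀` of `A₀` with `ψ₀² = -δ`
(resp. a CM-field presentation), including — when `E₀` HAS complex multiplication — structures that are NOT of Weil type (e.g. `ψ₀ =` the CM of `E₀`
acting diagonally on `E₀^{2p}`: multiplicities `(2p, 0)`), whose Weil space is of Hodge type `(2p,0)+(0,2p)` and contains no non-zero rational `(p,p)`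
class (Moonen–Zarhin's criterion); there §1 demands a carrier for a non-Hodge class, which no Chern character supplies. For `E₀` WITHOUT complex
multiplication every such structure is of Weil type (`ψ₀` is a rational matrix; its eigenvalues on `H^{1,0} = H^{1,0}(E₀) ⊗ ℚⁿ` are balanced), so §1 is
sane exactly there. The guarded node below asks the one carried class ONLY at structures exhibiting a non-zero rational `(p,p)` Weil class (read on `X`)
— which is all André's pencils ever deliver (the extended section of a non-zero anchored class is non-zero at the tensor fibre: flat sections of a
smooth projective family over a connected base vanish nowhere or everywhere) — and is implied both by §1 and by `EllipticTensorWeilCarriers 𝒪 E₀`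
(carry the witness itself). The companion files use ONLY the guarded node. -/

/-- **ONE CARRIED `E`-WEIL CLASS PER TENSOR STRUCTURE WITH A HODGE WITNESS, over `E₀`, for the door `𝒪` (`OneTensorWeilHodgeClassCarriers 𝒪 E₀`)** — the
GUARDED form of `OneTensorWeilClassCarriers`: for all `n`, `p` with `2 ≤ p ≤ n − 2`, every `X` with a polarisation class `θ`, every abelian `n`-fold `A₀ ≅ X`
(chart `e`) isogenous to a power of `E₀`, every endomorphism `ψ₀` of `A₀`, and each kind of CM-field structure (`ψ₀² = -δ`, `n = 2p`, Weil space
`weilClassesOf A₀ ψ₀ p δ`; or a presentation `(ψ₀, P)` of degree `e' > 2`, `n = p·e'`, Weil space `weilClassesField A₀ ψ₀ P (2p)`): IF some NON-ZERO RATIONAL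
class `w'` on `X` of Hodge type `(p,p)` has `e^*w'` in that Weil space (so the structure is of Weil type, Moonen–Zarhin), THEN some non-zero rational class
`w` on `X` with `e^*w` in the same Weil space HAS an `𝒪`-datum modulo the `θ`-ray (`w ∈ carriedClasses 𝒪 n p X θ`). ONE class per structure and
polarisation, of our choice. Implied by `OneTensorWeilClassCarriers 𝒪 E₀` and by `EllipticTensorWeilCarriers 𝒪 E₀` (companion file). With the line facts and
the door: `AndreSplitWeilClasses` and `HC_CM` (companion files). OPEN; not in print; NOT implied by the Hodge conjecture; a HYPOTHESIS wherever used.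
[cite: Andre1996Motifs, §6.3 a) (p. 32), Lemme 6.3.3 and proof (p. 33)] [cite: MoonenZarhin1998WeilClasses, §1 (Criterion; dim_F W_F = 1)]
[cite: Markman2025SurveySecant, §4] [cite: Bloch1972Semiregularity, Remark (7.5)] -/
@[conjecture] def OneTensorWeilHodgeClassCarriers (𝒪 : ObjClass) (E₀ : AbelianVariety ℂ) : Prop :=
  ∀ n p : ℕ, 2 ≤ p → p + 2 ≤ n →
    ∀ (X : SchemeOver ℂ) (θ : complexBetti X 2), IsPolarizationClass n X θ →
      ∀ (A₀ : AbelianVariety ℂ) (e : A₀.X ≅ X) (N : ℕ) (ψ₀ : A₀ ⟶ A₀), A₀.dim = n → A₀.IsIsogenous (E₀.powSucc N) →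
        (∀ δ : ℕ, 0 < δ → ψ₀ ≫ ψ₀ = -(δ • 𝟙 A₀) → n = 2 * p →
          (∃ w' : complexBetti X (2 * p), IsRationalClass w' ∧ w' ≠ 0 ∧ IsOfHodgeType n X (2 * p) p p w' ∧
              complexBetti.map e.hom (2 * p) w' ∈ weilClassesOf A₀ ψ₀ p δ) →
            ∃ w : complexBetti X (2 * p), IsRationalClass w ∧ w ≠ 0 ∧
              complexBetti.map e.hom (2 * p) w ∈ weilClassesOf A₀ ψ₀ p δ ∧ w ∈ carriedClasses 𝒪 n p X θ) ∧
        (∀ (P : Polynomial ℤ) (e' : ℕ),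
            P.Monic → P.natDegree = e' → 2 < e' → Irreducible (P.map (Int.castRingHom ℚ)) →
            Polynomial.eval₂ (Int.castRingHom (CategoryTheory.End A₀)) (ψ₀ : CategoryTheory.End A₀) P = 0 →
            n = p * e' →
            (∀ ρ : ℂ, Polynomial.eval₂ (Int.castRingHom ℂ) ρ P = 0 → starRingEnd ℂ ρ ≠ ρ) →
            (∃ Q : Polynomial ℚ, ∀ ρ : ℂ, Polynomial.eval₂ (Int.castRingHom ℂ) ρ P = 0 →
                Polynomial.eval₂ (algebraMap ℚ ℂ) ρ Q = starRingEnd ℂ ρ) →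
            (∃ w' : complexBetti X (2 * p), IsRationalClass w' ∧ w' ≠ 0 ∧ IsOfHodgeType n X (2 * p) p p w' ∧
                complexBetti.map e.hom (2 * p) w' ∈ weilClassesField A₀ ψ₀ P (2 * p)) →
              ∃ w : complexBetti X (2 * p), IsRationalClass w ∧ w ≠ 0 ∧
                complexBetti.map e.hom (2 * p) w ∈ weilClassesField A₀ ψ₀ P (2 * p) ∧ w ∈ carriedClasses 𝒪 n p X θ)

/-- **The guarded TWISTED node (`OneTensorWeilHodgeClassTwistedCarriers E₀`)**: `OneTensorWeilHodgeClassCarriers` for the road's twisted door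
`twistedReflexiveClass C AdmTw`, every Chern character theory `C`. OPEN; not in print; a HYPOTHESIS wherever used. [cite: Bloch1972Semiregularity, Remark (7.5)]
[cite: Markman2025SecantWeil, §7.3] [cite: BuchweitzFlenner2003, §5 Thm. 5.1] -/
@[conjecture] def OneTensorWeilHodgeClassTwistedCarriers (E₀ : AbelianVariety ℂ) : Prop :=
  ∀ C : ChernCharacterBetti, OneTensorWeilHodgeClassCarriers (twistedReflexiveClass C
    (fun n X₀ I E => Summit.Ventures.HSemireg.gluableSigmaAdmissible n X₀ I E ∨
      Literature.AlgebraicGeometry.HodgeTheory.bfSingleAdmissible n X₀ I E)) E₀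

/-! ## §3 (appended) The guarded node CELL BY CELL, and its SMALLEST OPEN INSTANCE as an argument-free statement: ONE carried codimension-2 Weil class
per quartic CM-field structure on the eightfolds isogenous to `E₀⁸`, for SOME elliptic curve `E₀` -/

/-- **The guarded one-class statement AT THE CELL `(n, p)` over `E₀`, for the door `𝒪` (`OneTensorWeilHodgeClassCarriersAt 𝒪 E₀ n p`)**: the body of
`OneTensorWeilHodgeClassCarriers 𝒪 E₀` at fixed `(n, p)` (no mid-range prefix). At `(n, p)` only CM-field structures with `n = p·[E':ℚ]` occur non-vacuously
(`n = 2p` in the quadratic branch, `n = p·e'` in the general one), so `(8, 2)` concerns QUARTIC structures only, `(8, 4)` and `(6, 3)` imaginary quadratic ones.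
The LINE engine (`VHCAbelianSchemesRoadWeilLineAnchors` §2) consumes exactly this statement at `(dim B, p)`. OPEN; not in print; a HYPOTHESIS wherever used.
[cite: Andre1996Motifs, Lemme 6.3.3 and proof (p. 33)] [cite: MoonenZarhin1998WeilClasses, §1] [cite: Bloch1972Semiregularity, Remark (7.5)] -/
@[conjecture] def OneTensorWeilHodgeClassCarriersAt (𝒪 : ObjClass) (E₀ : AbelianVariety ℂ) (n p : ℕ) : Prop :=
  ∀ (X : SchemeOver ℂ) (θ : complexBetti X 2), IsPolarizationClass n X θ →
    ∀ (A₀ : AbelianVariety ℂ) (e : A₀.X ≅ X) (N : ℕ) (ψ₀ : A₀ ⟶ A₀), A₀.dim = n → A₀.IsIsogenous (E₀.powSucc N) →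
      (∀ δ : ℕ, 0 < δ → ψ₀ ≫ ψ₀ = -(δ • 𝟙 A₀) → n = 2 * p →
        (∃ w' : complexBetti X (2 * p), IsRationalClass w' ∧ w' ≠ 0 ∧ IsOfHodgeType n X (2 * p) p p w' ∧
            complexBetti.map e.hom (2 * p) w' ∈ weilClassesOf A₀ ψ₀ p δ) →
          ∃ w : complexBetti X (2 * p), IsRationalClass w ∧ w ≠ 0 ∧
            complexBetti.map e.hom (2 * p) w ∈ weilClassesOf A₀ ψ₀ p δ ∧ w ∈ carriedClasses 𝒪 n p X θ) ∧
      (∀ (P : Polynomial ℤ) (e' : ℕ),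
          P.Monic → P.natDegree = e' → 2 < e' → Irreducible (P.map (Int.castRingHom ℚ)) →
          Polynomial.eval₂ (Int.castRingHom (CategoryTheory.End A₀)) (ψ₀ : CategoryTheory.End A₀) P = 0 →
          n = p * e' →
          (∀ ρ : ℂ, Polynomial.eval₂ (Int.castRingHom ℂ) ρ P = 0 → starRingEnd ℂ ρ ≠ ρ) →
          (∃ Q : Polynomial ℚ, ∀ ρ : ℂ, Polynomial.eval₂ (Int.castRingHom ℂ) ρ P = 0 →
              Polynomial.eval₂ (algebraMap ℚ ℂ) ρ Q = starRingEnd ℂ ρ) →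
          (∃ w' : complexBetti X (2 * p), IsRationalClass w' ∧ w' ≠ 0 ∧ IsOfHodgeType n X (2 * p) p p w' ∧
              complexBetti.map e.hom (2 * p) w' ∈ weilClassesField A₀ ψ₀ P (2 * p)) →
            ∃ w : complexBetti X (2 * p), IsRationalClass w ∧ w ≠ 0 ∧
              complexBetti.map e.hom (2 * p) w ∈ weilClassesField A₀ ψ₀ P (2 * p) ∧ w ∈ carriedClasses 𝒪 n p X θ)

/-- **THE SMALLEST OPEN INSTANCE OF THE COLUMN, argument-free (`QuarticTensorEightfoldOneTwistedCarrier`)**: for SOME complex elliptic curve `E₀`, the guarded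
one-class statement for the road's twisted door (every Chern character theory `C`) at the single cell `(8, 2)` over `E₀` — i.e. on every polarised complex scheme
`X ≅ A₀`, `A₀` an abelian EIGHTFOLD isogenous to a power of `E₀`, for every QUARTIC CM-field structure `(ψ₀, P)` on `A₀` (`[E':ℚ] = 4`, `8 = 2·4`) exhibiting a non-zero
rational `(2,2)` Weil witness, ONE non-zero rational codimension-2 `E'`-Weil class carries an AdmTw-admissible `B`-twisted perfect complex modulo the `θ`-ray
(`κ₂ = a·w + c₂·θ²`, `a ≠ 0`, sides `c_q·θ^q`). With Kodaira-free inputs K-C ∧ `TwistedPerfectDoor` ∧ Lemme 6.3.3 alone (line form) it yields the codimension-2 Weil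
classes of EVERY split Weil eightfold with multiplication by a QUARTIC CM field (companion rows file §7) — the K3-partner habitat; «not known to be algebraic (nor
Künneth-algebraic)» for `E⁺ ≠ ℚ` (André 2026 §4.4.4); Markman's secant-type reduction for `[K:ℚ] > 2` likewise rests on ONE semiregular object, «not addressed yet»
(arXiv:2509.23079 §1.1). A FIND-THE-SHEAF problem on `E₀⁸`; OPEN; not in print; NOT implied by the Hodge conjecture; a HYPOTHESIS wherever used.
[cite: Andre1996Motifs, Lemme 6.3.3 and proof (p. 33)] [cite: Andre2026, §4.4.4] [cite: Markman2025SecantRealMultiplication, §1.1] [cite: Bloch1972Semiregularity, Remark (7.5)]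
[cite: BuchweitzFlenner2003, §5 Thm. 5.1] -/
@[conjecture] def QuarticTensorEightfoldOneTwistedCarrier : Prop :=
  ∃ E₀ : AbelianVariety ℂ, E₀.dim = 1 ∧ ∀ C : ChernCharacterBetti,
    OneTensorWeilHodgeClassCarriersAt (twistedReflexiveClass C
      (fun n X₀ I E => Summit.Ventures.HSemireg.gluableSigmaAdmissible n X₀ I E ∨
        Literature.AlgebraicGeometry.HodgeTheory.bfSingleAdmissible n X₀ I E)) E₀ 8 2

/-! ## §4 (appended) The twisted per-cell node OVER A PRESCRIBED ANCHOR VARIETY `Y₀`, and two argument-free instances anchored at varieties OF OUR CHOICE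

PART AE-II (André's proof of Lemme 6.3.3 takes «une ℚ-structure de Hodge de type (1,0)+(0,1) de rang 2p» ARBITRARY — «par exemple» an elliptic power —
Literature `andre1996_splitWeilClasses_weilLinePencil_over` / `andre1996_cmHodgeClasses_weilLinePencils_over`, statement only): the special fibre may be
prescribed isogenous to a power of ANY `Y₀` with `0 < dim Y₀ ∣ p` whose powers satisfy the Hodge conjecture (a theorem of the tree for `dim Y₀ ≤ 3`). The nodes
of §§1–3 are already parametric in the anchor variety (written `E₀` there; no dimension constraint inside the definitions); this section only names the twisted
per-cell form and two argument-free instances. PART AE (evidence on the crux item: «no split carriers at Weil-type points») says the carried object must be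
indecomposable with Chern character in the generic Hodge ring of the Weil family — at `(6,3)` over a generic genus-3 Jacobian `Y₀ = J(C)` the special fibre
`J(C) ⊗ 𝒪_K` is exactly the anchor of Markman's semiregular μ_{8d}-twisted reflexive secant sheaves (in print, every `d`), so THAT instance is supported by
print modulo the door's format (twisted sheaf on a quotient by a finite group; sides in the `E′⁺θ`-algebra rather than on the `θ`-ray); the `(8,2)` instance
over an abelian surface is Markman's postponed real-multiplication case («not addressed yet»). -/

/-- **The guarded TWISTED node AT THE CELL `(n, p)` over the anchor variety `Y₀` (`OneTensorWeilHodgeClassTwistedCarriersAt Y₀ n p`)**: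
`OneTensorWeilHodgeClassCarriersAt` for the road's twisted door `twistedReflexiveClass C AdmTw`, every Chern character theory `C` — on every polarised `X ≅ A₀`,
`A₀` an abelian `n`-fold isogenous to a power of `Y₀`, for every CM-field structure on `A₀` exhibiting a non-zero rational `(p,p)` Weil witness, ONE non-zero
rational Weil class carries an AdmTw-admissible `B`-twisted perfect complex modulo the `θ`-ray. OPEN; not in print in this form; NOT implied by the Hodge conjecture;
a HYPOTHESIS wherever used. [cite: Andre1996Motifs, proof of Lemme 6.3.3 (p. 33)] [cite: Bloch1972Semiregularity, Remark (7.5)] [cite: Markman2025SecantWeil, §7.3]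
[cite: BuchweitzFlenner2003, §5 Thm. 5.1] -/
@[conjecture] def OneTensorWeilHodgeClassTwistedCarriersAt (Y₀ : AbelianVariety ℂ) (n p : ℕ) : Prop :=
  ∀ C : ChernCharacterBetti, OneTensorWeilHodgeClassCarriersAt (twistedReflexiveClass C
    (fun n X₀ I E => Summit.Ventures.HSemireg.gluableSigmaAdmissible n X₀ I E ∨
      Literature.AlgebraicGeometry.HodgeTheory.bfSingleAdmissible n X₀ I E)) Y₀ n p

/-- **THE `(6,3)` INSTANCE OVER A THREEFOLD OF OUR CHOICE, argument-free (`SexticTensorSixfoldOneTwistedCarrierOverThreefold`)**: for SOME complex abelian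
THREEFOLD `Y₀`, the guarded twisted one-class statement at the cell `(6, 3)` over `Y₀` — on every polarised `X ≅ A₀`, `A₀` an abelian sixfold isogenous to a
power of `Y₀` (so to `Y₀ ⊗ 𝒪_K`, `K` imaginary quadratic), for every imaginary-quadratic structure `ψ₀` (`ψ₀² = -δ`) exhibiting a non-zero rational `(3,3)` Weil
witness, ONE non-zero rational codimension-3 Weil class carries an AdmTw-admissible twisted complex modulo `θ³`. With K-C ∧ `TwistedPerfectDoor` ∧ the
prescribed-fibre split fact it yields the codimension-3 Weil classes of every split Weil sixfold with imaginary-quadratic multiplication (companion rows). For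
`Y₀ = J(C)`, `C` a generic curve of genus 3, the anchors `J(C) ⊗ 𝒪_K ≅ (J × Ĵ, η_d)` are those of Markman's semiregular twisted secant sheaves (every `d`) —
the one instance of the column whose object EXISTS IN PRINT, modulo the door's format. OPEN as typed; a HYPOTHESIS wherever used.
[cite: Markman2025SecantWeil, §1 Thm. 1 and §7.3] [cite: Andre1996Motifs, proof of Lemme 6.3.3 (p. 33)] [cite: MoonenZarhin1999LowDim, Thm. 0.1 (4)]
[cite: Bloch1972Semiregularity, Remark (7.5)] -/
@[conjecture] def SexticTensorSixfoldOneTwistedCarrierOverThreefold : Prop :=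
  ∃ Y₀ : AbelianVariety ℂ, Y₀.dim = 3 ∧ OneTensorWeilHodgeClassTwistedCarriersAt Y₀ 6 3

/-- **THE `(8,2)` INSTANCE OVER A SURFACE OF OUR CHOICE, argument-free (`QuarticTensorEightfoldOneTwistedCarrierOverSurface`)**: for SOME complex abelian SURFACE
`Y₀`, the guarded twisted one-class statement at the cell `(8, 2)` over `Y₀` — on every polarised `X ≅ A₀`, `A₀` an abelian eightfold isogenous to a power of
`Y₀`, for every QUARTIC CM-field structure exhibiting a non-zero rational `(2,2)` Weil witness, ONE non-zero rational codimension-2 Weil class carries an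
AdmTw-admissible twisted complex modulo `θ²`. Companion of `QuarticTensorEightfoldOneTwistedCarrier` (§3, over an elliptic curve): with K-C ∧ `TwistedPerfectDoor` ∧
the prescribed-fibre split fact it yields the codimension-2 Weil classes of every split quartic-CM Weil eightfold. For `Y₀` with real multiplication data this is
Markman's real-multiplication anchor `X × X̂` (`dim X = 4`, `[K:ℚ] = 4`), where B-secant sheaves are exhibited but their semiregularity is «not addressed yet».
A FIND-THE-SHEAF problem; OPEN; not in print; a HYPOTHESIS wherever used. [cite: Markman2025SecantRealMultiplication, §1.1] [cite: Andre1996Motifs, proof of Lemme 6.3.3 (p. 33)]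
[cite: Andre2026, §4.4.4] [cite: Bloch1972Semiregularity, Remark (7.5)] -/
@[conjecture] def QuarticTensorEightfoldOneTwistedCarrierOverSurface : Prop :=
  ∃ Y₀ : AbelianVariety ℂ, Y₀.dim = 2 ∧ OneTensorWeilHodgeClassTwistedCarriersAt Y₀ 8 2

end Summit.HodgeConjecture.HodgeConjecture.Ring2.AbelianAll

end
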